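import Mathlib.MeasureTheory.Integral.IntervalIntegral.FundThmCalculus
import Mathlib.Analysis.SpecialFunctions.Sqrt
import Mathlib.MeasureTheory.Measure.Lebesgue.EqHaar
import Literature.Analysis.FluidPDE.SereginSverakScaledEnergy
import HarnessLib

/-!
# Seregin–Šverák 2009, proof of Lemma 3.5: the absorption estimate (as11), discharged

G. Seregin, V. Šverák, *On Type I singularities of the local axi-symmetric solutions of the
Navier–Stokes equations*, Comm. PDE 34 (2009), 171–201 = arXiv:0804.1803 (labels and pages
refer to the arXiv version). The accepted file `SereginSverakScaledEnergy.lean` vendors the four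
analytic inputs of the printed proof of Lemma 3.5 as named facts and proves the iteration; this
file DISCHARGES the second input,

* `SereginSverak2009.CubicAbsorption` ((as11), arXiv p. 10):
  `C(z_b, r; v) ≤ ε (E(z_b, r; v) + A(z_b, r; v)) + f₁(ε, …)` for every `ε > 0`, at all
  `z_b = (b e₃, 0)`, `|b| ≤ 1/4`, `0 < r < 1/4`, under the assumptions of Thm. 3.1,

as `SereginSverak2009.CubicAbsorption_holds`.

## The proof given here

The paper derives (as11) from the multiplicative inequality (as2) of Seregin–Zajaczkowski [S10]
(`C ≤ c A^μ M_{s,l}^{1/m} (E + H)^{(m-1)/m}`, Hölder + Gagliardo–Nirenberg) applied to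
`v̂ = v_φ e_φ` with the swirl bound (as7) of Lemma 3.3 (`(s,l) = (7/4, 10)`, (as8)) and to
`v̄ = v_ϱ e_ϱ + v₃ e₃` with the Type I bound (r3) (`(s,l) = (4, 12/7)`, (as9)), followed by
Young's inequality ((as10)–(as11)).

Under the hypotheses of Thm. 3.1 the Type I bound (r3) `|v(x,t)| ≤ C/√(-t)` controls the WHOLE
field `v`, and the limiting admissible case `(s, l) = (∞, 1)` of (as2)–(as3) (`m = 1`, `μ = 1`,
`κ = 1`, where (as2) reads `C ≤ A · M_{∞,1}` and is Hölder's inequality alone, no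
Gagliardo–Nirenberg inequality entering) already yields (as11) once the time interval is split at
`t = -(ηr)²`, `0 < η ≤ 1`: with `K = max(C, 1)`,

* on the window `-(ηr)² < t < 0`: `|v|³ ≤ K (-t)^{-1/2} |v|²`, the slices satisfy
  `∫_{𝒞(x_b, r)} |v(t)|² ≤ r A(z_b, r; v)` for a.e. `t`, and
  `∫_{-(ηr)²}^{0} K (-t)^{-1/2} dt = 2Kηr`, so this part of `C(z_b, r; v)` is at most
  `2Kη · A(z_b, r; v)`;
* before the window, `-r² < t ≤ -(ηr)²`: `|v| ≤ K/(ηr)` pointwise, and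
  `|Q(z_b, r)| ≤ r² · |B(x_b, 2r)| = 8 r⁵ |B₁|`, so this part is at most `8 |B₁| K³ η⁻³`.

Hence `C(z_b, r; v) ≤ 2Kη A(z_b, r; v) + 8|B₁|K³η⁻³` (`lintegral_cube_le_of_typeI`), and
`η = min(1, ε/(2K))` gives (as11) with `f₁ = 8|B₁|K³η⁻³` depending on `ε` and `C` only (the
smallness comes from the short window rather than from Young's inequality; the dissipation `E`,
the swirl bound (as7) and axial symmetry are not used). The statement proved is exactly the
vendored one; the printed route through (as7)–(as10) is not formalised here.

## Contents

* `SereginSverak2009.parCyl_eq_prod`, `spaceCyl_subset_ball`, `volume_parCyl_le`: the cylinder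
  `Q(z₀, r)` as a product set, `𝒞(x₀, r) ⊆ B(x₀, 2r)` (`‖y‖² = |y'|² + y₃²`, cf.
  `norm_sq_eq_cylRadius_sq_add` of `SereginSverakBlowupSelection.lean`, inlined here to keep the
  imports small), `|Q(z₀, r)| ≤ r² (2r)³ |B₁|`;
* `SereginSverak2009.lintegral_typeI_majorant`: `∫_{-a²}^{0} K/√(-t) dt = 2Ka` (FTC);
* `SereginSverak2009.lintegral_cube_le_of_typeI`: the estimate above for a field obeying the
  Type I bound a.e. on `Q((0, x₀), r)` (Tonelli and the definition of `A` as an essential supremum);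
* `SereginSverak2009.CubicAbsorption_holds`.

## References

* G. Seregin, V. Šverák, Comm. PDE 34 (2009), 171–201, arXiv:0804.1803, §3: Thm. 3.1 (r3),
  (as2)–(as3), Lemma 3.5 and its proof, (as5), (as7)–(as11) (pp. 9–10). [`SereginSverak2009`]
* G. Seregin, W. Zajaczkowski, *A sufficient condition of local regularity for the
  Navier–Stokes equations*, Zap. Nauchn. Sem. POMI 336 (2006), 46–54 (the paper's [S10]).
-/

noncomputable section

open MeasureTheory Set Function Filter Topology TopologicalSpace Metric
open scoped NNReal ENNReal

namespace Literature.Analysis.FluidPDE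

namespace SereginSverak2009

/-! ### Geometry and volume of the cylinders -/

/-- `Q(z₀, R) = ]t₀ - R², t₀[ × 𝒞(x₀, R)` as a product set (time first). [folklore] -/
theorem parCyl_eq_prod (z₀ : ℝ × EuclideanSpace ℝ (Fin 3)) (R : ℝ) :
    parCyl z₀ R = Ioo (z₀.1 - R ^ 2) z₀.1 ×ˢ spaceCyl z₀.2 R :=
  rfl

/-- `𝒞(x₀, r) ⊆ B(x₀, 2r)`: a point of the cylinder is within `√2 r < 2r` of its centre.
[folklore] -/
theorem spaceCyl_subset_ball (x₀ : EuclideanSpace ℝ (Fin 3)) (r : ℝ) :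
    spaceCyl x₀ r ⊆ ball x₀ (2 * r) := by
  intro x hx
  rw [mem_spaceCyl] at hx
  have hr : 0 < r := (cylRadius_nonneg _).trans_lt hx.1
  rw [mem_ball, dist_eq_norm]
  have h2 : (x - x₀) 2 = x 2 - x₀ 2 := rfl
  have hc : cylRadius (x - x₀) ^ 2 < r ^ 2 := by
    have h0 := cylRadius_nonneg (x - x₀)
    nlinarith [hx.1]
  rw [cylRadius_sq] at hc
  have hd : (x 2 - x₀ 2) ^ 2 < r ^ 2 :=
    sq_lt_sq' (by linarith [(abs_lt.1 hx.2).1]) (abs_lt.1 hx.2).2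
  have hsq : ‖x - x₀‖ ^ 2 < (2 * r) ^ 2 := by
    rw [EuclideanSpace.real_norm_sq_eq, Fin.sum_univ_three, h2]
    nlinarith
  exact lt_of_pow_lt_pow_left₀ 2 (by positivity) hsq

/-- `|Q(z₀, r)| ≤ r² · (2r)³ · |B₁|` (`|]t₀ - r², t₀[| = r²` and `𝒞(x₀, r) ⊆ B(x₀, 2r)`, whose
volume is `(2r)³ |B₁|`). [folklore] -/
theorem volume_parCyl_le (z₀ : ℝ × EuclideanSpace ℝ (Fin 3)) {r : ℝ} (hr : 0 < r) :
    volume (parCyl z₀ r) ≤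
      ENNReal.ofReal (r ^ 2) *
        (ENNReal.ofReal ((2 * r) ^ 3) * volume (ball (0 : EuclideanSpace ℝ (Fin 3)) 1)) := by
  rw [parCyl_eq_prod, Measure.volume_eq_prod, Measure.prod_prod, Real.volume_Ioo, sub_sub_cancel]
  gcongr
  calc volume (spaceCyl z₀.2 r) ≤ volume (ball z₀.2 (2 * r)) :=
        measure_mono (spaceCyl_subset_ball _ _)
    _ = ENNReal.ofReal ((2 * r) ^ 3) * volume (ball (0 : EuclideanSpace ℝ (Fin 3)) 1) := by
        rw [Measure.addHaar_ball volume z₀.2 (by positivity : (0 : ℝ) ≤ 2 * r),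
          finrank_euclideanSpace_fin]

/-! ### The Type I majorant in time -/

/-- `∫_{-a²}^{0} K/√(-t) dt = 2Ka` for `K, a ≥ 0`, as a lower Lebesgue integral: the integrability
in time of the Type I majorant `K/√(-t)` (fundamental theorem of calculus for `-2K√(-t)`, whose
derivative `K/√(-t)` is nonnegative). [folklore] -/
theorem lintegral_typeI_majorant {K a : ℝ} (hK : 0 ≤ K) (ha : 0 ≤ a) :
    ∫⁻ t in Ioo (-a ^ 2) 0, ENNReal.ofReal (K / Real.sqrt (-t)) = ENNReal.ofReal (2 * K * a) := by
  have hab : -a ^ 2 ≤ (0 : ℝ) := by nlinarith [sq_nonneg a]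
  have hcont : ContinuousOn (fun s : ℝ => -(2 * K * Real.sqrt (-s))) (Icc (-a ^ 2) 0) :=
    (Continuous.continuousOn (by fun_prop))
  have hderiv : ∀ t ∈ Ioo (-a ^ 2) 0,
      HasDerivAt (fun s : ℝ => -(2 * K * Real.sqrt (-s))) (K / Real.sqrt (-t)) t := by
    intro t ht
    have ht0 : -t ≠ 0 := by have := ht.2; intro h; linarith
    have h2 := (((hasDerivAt_neg t).sqrt ht0).const_mul (2 * K)).neg
    refine h2.congr_deriv ?_
    rw [neg_div, mul_neg, neg_neg, mul_one_div, mul_div_mul_left K (Real.sqrt (-t)) two_ne_zero]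
  have hpos : ∀ t ∈ Ioo (-a ^ 2) 0, 0 ≤ K / Real.sqrt (-t) :=
    fun t _ => div_nonneg hK (Real.sqrt_nonneg _)
  have hint : IntegrableOn (fun t : ℝ => K / Real.sqrt (-t)) (Ioc (-a ^ 2) 0) :=
    intervalIntegral.integrableOn_deriv_of_nonneg hcont hderiv hpos
  have hFTC : ∫ t in (-a ^ 2)..0, K / Real.sqrt (-t) =
      -(2 * K * Real.sqrt (-0)) - -(2 * K * Real.sqrt (-(-a ^ 2))) :=
    intervalIntegral.integral_eq_sub_of_hasDerivAt_of_le hab hcont hderiv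
      ((intervalIntegrable_iff_integrableOn_Ioc_of_le hab).2 hint)
  calc ∫⁻ t in Ioo (-a ^ 2) 0, ENNReal.ofReal (K / Real.sqrt (-t))
      = ∫⁻ t in Ioc (-a ^ 2) 0, ENNReal.ofReal (K / Real.sqrt (-t)) := by
        rw [Measure.restrict_congr_set Ioo_ae_eq_Ioc]
    _ = ENNReal.ofReal (∫ t in Ioc (-a ^ 2) 0, K / Real.sqrt (-t)) := by
        rw [ofReal_integral_eq_lintegral_ofReal hint
          (Eventually.of_forall fun t => div_nonneg hK (Real.sqrt_nonneg _))]
    _ = ENNReal.ofReal (2 * K * a) := by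
        rw [← intervalIntegral.integral_of_le hab, hFTC]
        simp [Real.sqrt_sq ha]

/-! ### The absorption estimate under the Type I bound -/

/-- **The core of (as11) under the Type I bound (r3).** If `√(-t) ‖u(t, x)‖ ≤ K` a.e. on
`Q((0, x₀), r)` (`K ≥ 0`, `r > 0`) and `u` is a.e. strongly measurable there, then for every
`0 < η ≤ 1`
`∫_{Q((0,x₀), r)} |u|³ ≤ 2Kη · r² A((0, x₀), r; u) + (8K³/η³) · r² |B₁|`:
on the window `-(ηr)² < t < 0`, `|u|³ ≤ K(-t)^{-1/2} |u|²`, the slices carry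
`∫_{𝒞(x₀, r)} |u(t)|² ≤ r A` for a.e. `t` (definition of `A` as an essential supremum), and
`∫_{-(ηr)²}^{0} K(-t)^{-1/2} dt = 2Kηr`; before the window `|u| ≤ K/(ηr)` pointwise and
`|Q((0, x₀), r)| ≤ r² (2r)³ |B₁|`. This is (as2) in the limiting case `(s, l) = (∞, 1)`,
`m = μ = 1` (Hölder only), localised to the window.
[cite: SereginSverak2009, proof of Lemma 3.5, (as2) and (as11) (arXiv pp. 9–10)] -/
theorem lintegral_cube_le_of_typeI {u : ℝ → EuclideanSpace ℝ (Fin 3) → EuclideanSpace ℝ (Fin 3)}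
    {x₀ : EuclideanSpace ℝ (Fin 3)} {r : ℝ} (hr : 0 < r) {K : ℝ} (hK : 0 ≤ K)
    (hu : AEStronglyMeasurable (uncurry u) (volume.restrict (parCyl ((0 : ℝ), x₀) r)))
    (hI : ∀ᵐ z ∂(volume.restrict (parCyl ((0 : ℝ), x₀) r)), Real.sqrt (-z.1) * ‖u z.1 z.2‖ ≤ K)
    {η : ℝ} (hη : 0 < η) (hη1 : η ≤ 1) :
    ∫⁻ z in parCyl ((0 : ℝ), x₀) r, ‖u z.1 z.2‖ₑ ^ (3 : ℕ) ≤
      ENNReal.ofReal (2 * K * η) * ENNReal.ofReal r ^ 2 * energyA ((0 : ℝ), x₀) r u +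
        ENNReal.ofReal (8 * K ^ 3 / η ^ 3) * ENNReal.ofReal r ^ 2 *
          volume (ball (0 : EuclideanSpace ℝ (Fin 3)) 1) := by
  -- notation
  set Q : Set (ℝ × EuclideanSpace ℝ (Fin 3)) := parCyl ((0 : ℝ), x₀) r with hQ
  set I : Set ℝ := Ioo ((0 : ℝ) - r ^ 2) 0 with hIdef
  set S : Set (EuclideanSpace ℝ (Fin 3)) := spaceCyl x₀ r with hS
  set J : Set ℝ := Ioo (-(η * r) ^ 2) 0 with hJ
  set A : ℝ≥0∞ := energyA ((0 : ℝ), x₀) r u with hA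
  set ρ : ℝ≥0∞ := ENNReal.ofReal r with hρ
  have hρ0 : ρ ≠ 0 := (ENNReal.ofReal_pos.2 hr).ne'
  have hρT : ρ ≠ ⊤ := ENNReal.ofReal_ne_top
  have hQprod : Q = I ×ˢ S := rfl
  have hηr : 0 < η * r := mul_pos hη hr
  have hJI : J ⊆ I := by
    refine Ioo_subset_Ioo ?_ le_rfl
    have h2 : η * r ≤ r := mul_le_of_le_one_left hr.le hη1
    have : (η * r) ^ 2 ≤ r ^ 2 := pow_le_pow_left₀ hηr.le h2 2
    linarith
  -- the majorant in time, supported on the window `J`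
  set g : ℝ → ℝ≥0∞ := J.indicator fun t => ENNReal.ofReal (K / Real.sqrt (-t)) with hg
  have hg_meas : Measurable g := by
    refine Measurable.indicator ?_ measurableSet_Ioo
    fun_prop
  have hg_top : ∀ t, g t ≠ ⊤ := by
    intro t
    by_cases ht : t ∈ J
    · rw [hg, indicator_of_mem ht]; exact ENNReal.ofReal_ne_top
    · rw [hg, indicator_of_notMem ht]; exact ENNReal.zero_ne_top
  set c₀ : ℝ≥0∞ := ENNReal.ofReal ((K / (η * r)) ^ 3) with hc₀
  -- Step 1: the pointwise bound, a.e. on `Q`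
  have hpt : ∀ᵐ z ∂(volume.restrict Q),
      ‖u z.1 z.2‖ₑ ^ (3 : ℕ) ≤ g z.1 * ‖u z.1 z.2‖ₑ ^ 2 + c₀ := by
    filter_upwards [hI, ae_restrict_mem (isOpen_parCyl _ _).measurableSet] with z hz hzQ
    have ht : z.1 ∈ I := hzQ.1
    have ht0 : 0 < -z.1 := by have := ht.2; linarith
    have hs0 : 0 < Real.sqrt (-z.1) := Real.sqrt_pos.2 ht0
    have hnorm : ‖u z.1 z.2‖ ≤ K / Real.sqrt (-z.1) := by
      rw [le_div_iff₀ hs0, mul_comm]; exact hz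
    have he : ‖u z.1 z.2‖ₑ = ENNReal.ofReal ‖u z.1 z.2‖ := (ofReal_norm _).symm
    by_cases hzJ : z.1 ∈ J
    · have hgz : g z.1 = ENNReal.ofReal (K / Real.sqrt (-z.1)) := by
        rw [hg, indicator_of_mem hzJ]
      have hen : ‖u z.1 z.2‖ₑ ≤ ENNReal.ofReal (K / Real.sqrt (-z.1)) := by
        rw [he]; exact ENNReal.ofReal_le_ofReal hnorm
      calc ‖u z.1 z.2‖ₑ ^ (3 : ℕ) = ‖u z.1 z.2‖ₑ * ‖u z.1 z.2‖ₑ ^ 2 := by ring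
        _ ≤ g z.1 * ‖u z.1 z.2‖ₑ ^ 2 := by rw [hgz]; exact mul_le_mul' hen le_rfl
        _ ≤ g z.1 * ‖u z.1 z.2‖ₑ ^ 2 + c₀ := le_self_add
    · -- before the window: `z.1 ≤ -(ηr)²`, so `√(-z.1) ≥ ηr`
      have hle : z.1 ≤ -(η * r) ^ 2 := not_lt.1 fun h => hzJ ⟨h, ht.2⟩
      have hsq : η * r ≤ Real.sqrt (-z.1) := by
        rw [Real.le_sqrt hηr.le ht0.le]; linarith
      have hnorm' : ‖u z.1 z.2‖ ≤ K / (η * r) :=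
        hnorm.trans (div_le_div_of_nonneg_left hK hηr hsq)
      calc ‖u z.1 z.2‖ₑ ^ (3 : ℕ) = ENNReal.ofReal (‖u z.1 z.2‖ ^ 3) := by
            rw [he, ENNReal.ofReal_pow (norm_nonneg _)]
        _ ≤ c₀ := ENNReal.ofReal_le_ofReal (pow_le_pow_left₀ (norm_nonneg _) hnorm' 3)
        _ ≤ g z.1 * ‖u z.1 z.2‖ₑ ^ 2 + c₀ := le_add_self
  -- Step 2: the slices, a.e. in `t` (definition of `A`)
  have hslice : ∀ᵐ t ∂(volume.restrict I), ∫⁻ x in S, ‖u t x‖ₑ ^ 2 ≤ ρ * A := by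
    have h : ∀ᵐ t ∂(volume.restrict I), ρ⁻¹ * ∫⁻ x in S, ‖u t x‖ₑ ^ 2 ≤ A :=
      ENNReal.ae_le_essSup _
    filter_upwards [h] with t ht
    calc ∫⁻ x in S, ‖u t x‖ₑ ^ 2 = ρ * (ρ⁻¹ * ∫⁻ x in S, ‖u t x‖ₑ ^ 2) := by
          rw [← mul_assoc, ENNReal.mul_inv_cancel hρ0 hρT, one_mul]
      _ ≤ ρ * A := mul_le_mul' le_rfl ht
  -- Step 3: Tonelli on `Q = I × S`
  have hμ : volume.restrict Q = (volume.restrict I).prod (volume.restrict S) := by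
    rw [hQprod]; exact (Measure.prod_restrict I S).symm
  have hF : AEMeasurable (fun z : ℝ × EuclideanSpace ℝ (Fin 3) => g z.1 * ‖u z.1 z.2‖ₑ ^ 2)
      (volume.restrict Q) :=
    (hg_meas.comp measurable_fst).aemeasurable.mul (hu.enorm.pow_const 2)
  have hF' : AEMeasurable (fun z : ℝ × EuclideanSpace ℝ (Fin 3) => g z.1 * ‖u z.1 z.2‖ₑ ^ 2)
      ((volume.restrict I).prod (volume.restrict S)) := hμ ▸ hF
  have hmain : ∫⁻ z in Q, g z.1 * ‖u z.1 z.2‖ₑ ^ 2 ≤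
      ENNReal.ofReal (2 * K * (η * r)) * (ρ * A) := by
    calc ∫⁻ z in Q, g z.1 * ‖u z.1 z.2‖ₑ ^ 2
        = ∫⁻ t in I, ∫⁻ x in S, g t * ‖u t x‖ₑ ^ 2 := by
          rw [hμ, lintegral_prod _ hF']
      _ = ∫⁻ t in I, g t * ∫⁻ x in S, ‖u t x‖ₑ ^ 2 :=
          lintegral_congr fun t => lintegral_const_mul' _ _ (hg_top t)
      _ ≤ ∫⁻ t in I, g t * (ρ * A) :=
          lintegral_mono_ae (hslice.mono fun t ht => mul_le_mul' le_rfl ht)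
      _ = (∫⁻ t in I, g t) * (ρ * A) := lintegral_mul_const _ hg_meas
      _ = (∫⁻ t in J, ENNReal.ofReal (K / Real.sqrt (-t))) * (ρ * A) := by
          rw [hg, lintegral_indicator measurableSet_Ioo,
            Measure.restrict_restrict measurableSet_Ioo, inter_eq_left.2 hJI]
      _ = ENNReal.ofReal (2 * K * (η * r)) * (ρ * A) := by
          rw [hJ, lintegral_typeI_majorant hK hηr.le]
  -- Step 4: integrate the pointwise bound and collect the constants
  have hvol := volume_parCyl_le ((0 : ℝ), x₀) hr
  calc ∫⁻ z in Q, ‖u z.1 z.2‖ₑ ^ (3 : ℕ)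
      ≤ ∫⁻ z in Q, (g z.1 * ‖u z.1 z.2‖ₑ ^ 2 + c₀) := lintegral_mono_ae hpt
    _ = (∫⁻ z in Q, g z.1 * ‖u z.1 z.2‖ₑ ^ 2) + c₀ * volume Q := by
        rw [lintegral_add_right _ measurable_const, setLIntegral_const]
    _ ≤ ENNReal.ofReal (2 * K * (η * r)) * (ρ * A) +
        c₀ * (ENNReal.ofReal (r ^ 2) *
          (ENNReal.ofReal ((2 * r) ^ 3) * volume (ball (0 : EuclideanSpace ℝ (Fin 3)) 1))) :=
        add_le_add hmain (mul_le_mul' le_rfl hvol)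
    _ = ENNReal.ofReal (2 * K * η) * ρ ^ 2 * A +
        ENNReal.ofReal (8 * K ^ 3 / η ^ 3) * ρ ^ 2 *
          volume (ball (0 : EuclideanSpace ℝ (Fin 3)) 1) := by
        have e1 : ENNReal.ofReal (2 * K * (η * r)) * (ρ * A) =
            ENNReal.ofReal (2 * K * η) * ρ ^ 2 * A := by
          rw [show 2 * K * (η * r) = (2 * K * η) * r by ring,
            ENNReal.ofReal_mul (by positivity), hρ]
          ring
        have e2 : c₀ * (ENNReal.ofReal (r ^ 2) *
            (ENNReal.ofReal ((2 * r) ^ 3) * volume (ball (0 : EuclideanSpace ℝ (Fin 3)) 1))) =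
            ENNReal.ofReal (8 * K ^ 3 / η ^ 3) * ρ ^ 2 *
              volume (ball (0 : EuclideanSpace ℝ (Fin 3)) 1) := by
          rw [hc₀, ← mul_assoc, ← mul_assoc, ← ENNReal.ofReal_mul (by positivity),
            ← ENNReal.ofReal_mul (by positivity), hρ, ← ENNReal.ofReal_pow hr.le,
            ← ENNReal.ofReal_mul (by positivity)]
          congr 2
          field_simp
          ring
        rw [e1, e2]

/-- **Seregin–Šverák 2009, proof of Lemma 3.5, (as11), discharged**:
`theorem CubicAbsorption_holds : CubicAbsorption`. Under the assumptions of Thm. 3.1 — in fact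
from the Type I bound (r3) `√(-t) |v| ≤ C` a.e. on `Q` and the measurability of `v` alone — for
every `ε > 0` there is `F` with `C(z_b, r; v) ≤ ε (E(z_b, r; v) + A(z_b, r; v)) + F` at all
`z_b = (b e₃, 0)`, `|b| ≤ 1/4`, `0 < r < 1/4`: apply `lintegral_cube_le_of_typeI` on
`Q(z_b, r) ⊆ Q` with `K = max(C, 1)` and the window parameter `η = min(1, ε/(2K))`, so that
`C(z_b, r; v) ≤ 2Kη A + 8|B₁|K³η⁻³ ≤ ε A + F`, `F = 8|B₁|K³η⁻³` (the printed `f₁(ε, C, C₂)`).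
See the module docstring for the relation with the printed derivation via (as2), (as7)–(as10).
[cite: SereginSverak2009, proof of Lemma 3.5, (as11) (arXiv p. 10)] -/
theorem CubicAbsorption_holds : CubicAbsorption := by
  intro u p hsol hI G _hG ε hε
  obtain ⟨C, hC⟩ := hI
  -- the Type I constant, made `≥ 1`
  set K : ℝ := max C 1 with hK
  have hK0 : 0 < K := lt_of_lt_of_le one_pos (le_max_right _ _)
  have hK0' : K ≠ 0 := hK0.ne'
  have hCK : ∀ᵐ z ∂(volume.restrict (parCyl 0 1)), Real.sqrt (-z.1) * ‖u z.1 z.2‖ ≤ K :=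
    hC.mono fun z hz => hz.trans (le_max_left _ _)
  -- the window parameter `η`
  have hε0 : (0 : ℝ) < ε := by exact_mod_cast hε
  set η : ℝ := min 1 ((ε : ℝ) / (2 * K)) with hη
  have hη0 : 0 < η := lt_min one_pos (by positivity)
  have hη1 : η ≤ 1 := min_le_left _ _
  have hKη : 2 * K * η ≤ ε := by
    calc 2 * K * η ≤ 2 * K * ((ε : ℝ) / (2 * K)) := by gcongr; exact min_le_right _ _
      _ = ε := by field_simp
  -- the constant `F = 8 |B₁| K³ / η³`
  have hV : volume (ball (0 : EuclideanSpace ℝ (Fin 3)) 1) ≠ ⊤ := measure_ball_lt_top.ne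
  set V : ℝ≥0 := (volume (ball (0 : EuclideanSpace ℝ (Fin 3)) 1)).toNNReal with hVdef
  have hVcoe : (V : ℝ≥0∞) = volume (ball (0 : EuclideanSpace ℝ (Fin 3)) 1) :=
    ENNReal.coe_toNNReal hV
  set F : ℝ≥0 := Real.toNNReal (8 * K ^ 3 / η ^ 3) * V with hF
  have hFcoe :
      ENNReal.ofReal (8 * K ^ 3 / η ^ 3) * volume (ball (0 : EuclideanSpace ℝ (Fin 3)) 1) = F := by
    rw [hF, ENNReal.coe_mul, hVcoe]
    rfl
  have ha : ENNReal.ofReal (2 * K * η) ≤ ε := by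
    rw [← ENNReal.ofReal_coe_nnreal]; exact ENNReal.ofReal_le_ofReal hKη
  refine ⟨F, fun b hb r hr => ?_⟩
  -- Type I and measurability on `Q(z_b, r) ⊆ Q`
  have hsub : parCyl ((0 : ℝ), b • eZ) r ⊆ parCyl 0 1 :=
    parCyl_axis_subset hr.1.le (by linarith [hr.2])
  have hu : AEStronglyMeasurable (uncurry u) (volume.restrict (parCyl ((0 : ℝ), b • eZ) r)) :=
    hsol.distributional.1.aestronglyMeasurable.mono_measure (Measure.restrict_mono hsub le_rfl)
  have hIb : ∀ᵐ z ∂(volume.restrict (parCyl ((0 : ℝ), b • eZ) r)),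
      Real.sqrt (-z.1) * ‖u z.1 z.2‖ ≤ K :=
    ae_restrict_of_ae_restrict_of_subset hsub hCK
  have hcore := lintegral_cube_le_of_typeI hr.1 hK0.le hu hIb hη0 hη1
  -- normalise by `r²`
  set ρ : ℝ≥0∞ := ENNReal.ofReal r with hρ
  have hρ0 : ρ ≠ 0 := (ENNReal.ofReal_pos.2 hr.1).ne'
  have hρT : ρ ≠ ⊤ := ENNReal.ofReal_ne_top
  have hρ2 : (ρ ^ 2)⁻¹ * ρ ^ 2 = 1 :=
    ENNReal.inv_mul_cancel (pow_ne_zero _ hρ0) (ENNReal.pow_ne_top hρT)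
  calc cubicC ((0 : ℝ), b • eZ) r u
      = (ρ ^ 2)⁻¹ * ∫⁻ z in parCyl ((0 : ℝ), b • eZ) r, ‖u z.1 z.2‖ₑ ^ (3 : ℕ) := rfl
    _ ≤ (ρ ^ 2)⁻¹ * (ENNReal.ofReal (2 * K * η) * ρ ^ 2 * energyA ((0 : ℝ), b • eZ) r u +
          ENNReal.ofReal (8 * K ^ 3 / η ^ 3) * ρ ^ 2 *
            volume (ball (0 : EuclideanSpace ℝ (Fin 3)) 1)) :=
        mul_le_mul' le_rfl hcore
    _ = (ρ ^ 2)⁻¹ * ρ ^ 2 * (ENNReal.ofReal (2 * K * η) * energyA ((0 : ℝ), b • eZ) r u +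
          ENNReal.ofReal (8 * K ^ 3 / η ^ 3) * volume (ball (0 : EuclideanSpace ℝ (Fin 3)) 1)) := by
        ring
    _ = ENNReal.ofReal (2 * K * η) * energyA ((0 : ℝ), b • eZ) r u + F := by
        rw [hρ2, one_mul, hFcoe]
    _ ≤ ε * (dissipationE ((0 : ℝ), b • eZ) r G + energyA ((0 : ℝ), b • eZ) r u) + F :=
        add_le_add (mul_le_mul' ha le_add_self) le_rfl

end SereginSverak2009

end Literature.Analysis.FluidPDE
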